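import Summits.BirchSwinnertonDyer.Rank1Residual.X11b.RouteR1IntReceptacleOneSided
import Summits.BirchSwinnertonDyer.Rank1Residual.X11b.RouteR1LogOmega
import Summits.BirchSwinnertonDyer.Rank1Residual.X11b.BDPRouteControlUpper
import Summits.BirchSwinnertonDyer.Rank1Residual.X11b.BDPRouteHalves
import Summits.BirchSwinnertonDyer.Rank1Residual.X11b.BDPRouteSurjOdd
import HarnessLib

/-!
# Route `ErratumRoadFive` (K2, `p ≥ 5`): the EULER-SYSTEM HALF from the OTHER inclusion of the BDP main
# conjecture — «`L_𝔭 ∈ Ch_Λ(X_ac)·Λ`» (UB) ∘ the value at `𝟙` ∘ the control identity ⟹ the SHARP upper bound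
# `ord_p #Ш(E/K) + 2·ord_p ∏_ℓ c_ℓ(E) ≤ 2·ord_p [E(K):ℤP]` over a classical Heegner field, and its ℚ-descent

Cell `bsd-stepL` (run/shared/lean/pub/bsd-stepL/), seat `bsd-stepL-bdp` (prover g19, 2026-08-27).
`--supports stmt-BirchSwinnertonDyer-19715` (crux `EulerHalfNotRamNoInertSetAtFive` of route
`route-BirchSwinnertonDyer-ErratumRoadFive`; also bears on the aside 19062 `EulerHalfOffLocus`). THEOREMS ONLY;
THESES-FREE (X11b library + Literature imports only). Memo: HOME/proof/PROOF-BDP.md §43 (bdp g18: «UB is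
partner-free ⇒ a candidate input for the Euler-system half») and §45 (this session: the kernel form).

## What this file proves (pure algebra + bookkeeping; every hypothesis a tree shape)

The tree's STEP-L machinery (`X11b/HalvesReceptacle`, `RouteR1IntReceptacleOneSided`, `AnticyclotomicLowerLinks`,
`BDPRouteControlUpper`, `BDPRouteHalves`) runs the LOWER direction: `Ch_Λ(X_ac)·R ⊆ (L)` ∧ `L(𝟙) = u·((1 − a_p/p)·
log_ω P)²` ⟹ `2·(ord_p log_ω P − 1) ≤ ord_p f_ac(0)` ⟹ (with one-sided control) `2·ord_p[E(K):ℤP] ≤ ord_p #Ш(E/K)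
+ ord_p ∏_{w∣N⁺} c_w` ⟹ `Typed.MissingLowerBoundAt`. This file is the UPPER twin, line by line:

* §1 `EulerHalfUB.valuation_constantCoeff_le_int` — if `f ∈ Λ = ℤ_p⟦T⟧` has `f(0) ≠ 0`, `Q ∈ (f)·𝓞_{ℂ_p}⟦T⟧`
  (the divisibility UB read on a generator) and `Q(0) = u·((1 − a/p)·x)²` with `‖u‖ = 1`, `p ∤ a`, `x ≠ 0`, then
  `ord_p f(0) ≤ 2·(ord_p x − 1)`. Norms in `ℂ_p`: `p²‖x‖² = ‖Q(0)‖ = ‖G(0)‖·‖f(0)‖ ≤ ‖f(0)‖`. Unlike the lower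
  twin, `x ≠ 0` is an INPUT (for `x = 0` the membership says nothing about `f(0)`).
* §2 `EulerHalfUB.charValuation_le_of_span_le_of_intValue` — pointwise on tree objects: CTL₀
  (`HasCharValuationAt … 𝔮 … n`) ∧ UB♭ at the X-slot `𝔮` (`(Q) ⊆ Ch_Λ(X_ac 𝔮)·𝓞_{ℂ_p}⟦T⟧`) ∧ value♭
  (`Q(𝟙) = u·((1 − a/p)·log_{ω_E} P)²`, `‖u‖ = 1`) ∧ `P` of infinite order ⟹ `n ≤ 2·(ord_p log_{ω_E} P − 1)`
  (`log_{ω_E} P ≠ 0` by `R1.logOmega_ne_zero`).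
* §3 `EulerHalfUB.sha_add_tamagawaProductSplit_le_of_control` — with the control IDENTITY
  `ControlOnTreeAt p κ 𝔮 γ ι P` (Cas18 Thm. 2.3 ∕ JSW17 Thm. 3.3.1 shape; at `p ∥ N` a THEOREM from the published
  fact `JetchevSkinnerWan2017.thm331_anticyclotomicControl_mult`, `Theorems/ErratumRoadFiveControlFromJSWMult`):
  `ord_p #Ш(E/K)[p^∞] + ord_p ∏_{w∣N⁺} c_w(E/K) ≤ 2·ord_p [E(K):ℤP]`; over a classical Heegner field (`p ≥ 5`)
  `EulerHalfUB.shaIndexBoundSharp_of_heegner`: `ord_p #Ш(E/K) + 2·ord_p ∏_ℓ c_ℓ(E) ≤ 2·ord_p [E(K):ℤP]` —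
  Castella 2018 (5.2)–(5.3) with «≤», i.e. the Tamagawa-INCLUSIVE upper bound that Kolyvagin's
  `#Ш(E/K) ∣ p^{2·ord_p[E(K):ℤy_K]}` misses by exactly `2·ord_p ∏c` (`BDPRouteTamagawaDefect.lean`).
* §4 `EulerHalfUB.missingUpperBoundAt_of_shaIndexBoundSharp` — the ℚ-descent: the sharp bound over `K` + the
  Gross–Zagier bookkeeping (`exists_shaAn_padicVal_eq_of_heegner`) + the `≥`-half of the rank-`0` `p`-part of
  the twist `E^{d_K}` ⟹ `Typed.MissingUpperBoundAt W p` with NO Tamagawa condition (the tree's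
  `missingUpperBoundAt_of_shaIndexBound` needs `p ∤ ∏c`); `…_of_surj_odd` discharges the twist-model transports.

The class-level consumers (UB♭ at the X11b classical data from the ∃-frame shape, the control from the JSW
fact, the twist's half from Skinner 2016 Thm. C on (ram) ∕ from crux `X11aLowerHalf` on ¬(ram), and the body of
item 19715) are in the companion `Theorems/ErratumRoadFiveEulerHalfFromUB.lean`.

HONEST FRAMING: implications only. UB («`L_𝔭^{BDP}(f) ∈ Ch_Λ(X_ac)·Λ_{R₀}`», the Euler-system divisibility of
the BDP anticyclotomic main conjecture for `E` itself at `p ∥ N`) is NOT in print at any `p ∣ N` (lit g19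
EPS3-SOURCES §E.1); the cell holds it at MEMO grade only (PROOF-BDP §38.8 ∕ §38.10 ∕ §39 non-split, §41 split;
referee PASS on §38/38.8/38.9, §39/§41 owed). Nothing is discharged, booked or re-labelled (T7); BSD is proved
for no pair; item 19715 is NOT closed by this file.

References: [Castella2018] Thm. 2.3, Thm. 3.2, §5 (5.1)–(5.3) (arXiv:1704.06608 pp. 5, 9, 12);
[JetchevSkinnerWan2017] Thm. 3.3.1, §7.4.1–7.4.2 (arXiv:1512.06894 pp. 11, 30–31); [Howard2004Compositio]
Thm. B (the shape of UB at good `p`); [Castella2017ANT] App. A (HP ↔ BDP duality); [Miller2011LMS] Def. 1.1.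
-/

set_option autoImplicit false
set_option linter.dupNamespace false

noncomputable section

open scoped Classical

open WeierstrassCurve NumberField IsDedekindDomain Field PowerSeries
open Literature.NumberTheory.EllipticCurves
open Literature.NumberTheory.EllipticCurves.ModularForms
open Literature.NumberTheory.EllipticCurves.Rank1Residual
open Literature.NumberTheory.EllipticCurves.Rank1Residual.Typed
open Literature.NumberTheory.GaloisRepresentations
open Literature.NumberTheory.EllipticCurves.KrizLi2019
open Summit.BirchSwinnertonDyer.Rank1Residual Summit.BirchSwinnertonDyer.Rank1Residual.X11b
open Summit.BirchSwinnertonDyer.Rank1Residual.X11b.AcSelmer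
open Summit.BirchSwinnertonDyer.Rank1Residual.X11b.CongruenceLimit
open Summit.BirchSwinnertonDyer.Rank1Residual.X11b.Halves

namespace Summit.BirchSwinnertonDyer.BirchSwinnertonDyer.Theorems.EulerHalfUB

/-! ### §1 The algebra of the UPPER direction over the wide receptacle `𝓞_{ℂ_p}⟦T⟧` (every prime `p`) -/

section Algebra

variable (p : ℕ) [Fact p.Prime]

/-- From a real inequality between powers of `p` to the integer inequality (upper twin of
`Halves.two_mul_sub_one_le_of_zpow_le`). [folklore] -/
theorem le_two_mul_sub_one_of_zpow_le {n : ℕ} {v : ℤ}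
    (h : (p : ℝ) ^ 2 * ((p : ℝ) ^ (-v)) ^ 2 ≤ (p : ℝ) ^ (-(n : ℤ))) : (n : ℤ) ≤ 2 * (v - 1) := by
  have hp1 : (1 : ℝ) < p := by exact_mod_cast (Fact.out : p.Prime).one_lt
  have hp0 : (0 : ℝ) < p := by positivity
  have hrhs : (p : ℝ) ^ 2 * ((p : ℝ) ^ (-v)) ^ 2 = (p : ℝ) ^ (2 - 2 * v) := by
    rw [← zpow_natCast ((p : ℝ) ^ (-v)) 2, ← zpow_mul, ← zpow_natCast (p : ℝ) 2, ← zpow_add₀ hp0.ne']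
    congr 1
    push_cast
    ring
  rw [hrhs, zpow_le_zpow_iff_right₀ hp1] at h
  omega

/-- **The algebra of the UPPER direction.** If `f ∈ Λ = ℤ_p⟦T⟧` has non-zero constant term, `Q` lies in the
ideal generated by the image of `f` in `𝓞_{ℂ_p}⟦T⟧` (the Euler-system divisibility «`L ∈ Ch·Λ`» read on a
generator), and `Q(0) = u·((1 − a p⁻¹)·x)²` with `‖u‖ = 1`, `p ∤ a` and `x ≠ 0` (the value formula at `𝟙`), then
`ord_p f(0) ≤ 2·(ord_p x − 1)`. Norms in `ℂ_p`: `Q = G·f`, so `p²‖x‖² = ‖Q(0)‖ = ‖G(0)‖·‖f(0)‖ ≤ ‖f(0)‖`.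
The hypothesis `x ≠ 0` cannot be dropped (for `x = 0` the membership is silent about `f(0)`). [folklore] -/
theorem valuation_constantCoeff_le_int {f : IwasawaAlgebra p} (hf0 : constantCoeff f ≠ 0)
    {Q : PowerSeries 𝓞_ℂ_[p]} (hQf : Q ∈ Ideal.span {PowerSeries.map (R1.toCpInt p) f})
    {u : ℂ_[p]} (hu : ‖u‖ = 1) {a : ℤ} (ha : ¬ (p : ℤ) ∣ a) {x : ℚ_[p]} (hx : x ≠ 0)
    (hQ : IntSeries.HasValueAt Q 0 (u *
      (algebraMap ℚ_[p] ℂ_[p] (((1 : ℚ_[p]) - (a : ℚ_[p]) * (p : ℚ_[p])⁻¹) * x)) ^ 2)) :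
    ((constantCoeff f).valuation : ℤ) ≤ 2 * (x.valuation - 1) := by
  set y : ℚ_[p] := ((1 : ℚ_[p]) - (a : ℚ_[p]) * (p : ℚ_[p])⁻¹) * x with hy
  -- `Q(0)` is the constant term
  have hQ0 : u * (algebraMap ℚ_[p] ℂ_[p] y) ^ 2 = ((constantCoeff Q : 𝓞_ℂ_[p]) : ℂ_[p]) :=
    R1.intSeries_eq_constantCoeff_of_hasValueAt_zero p hQ
  -- `Q = G · (map f)`
  obtain ⟨G, hG⟩ := Ideal.mem_span_singleton'.mp hQf
  have hfac : ((constantCoeff Q : 𝓞_ℂ_[p]) : ℂ_[p]) =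
      ((constantCoeff G : 𝓞_ℂ_[p]) : ℂ_[p]) *
        algebraMap ℚ_[p] ℂ_[p] ((constantCoeff f : ℤ_[p]) : ℚ_[p]) := by
    rw [← hG, map_mul, MulMemClass.coe_mul, constantCoeff_map_apply, R1.coe_toCpInt]
  -- norms
  have hp1 : (1 : ℝ) < p := by exact_mod_cast (Fact.out : p.Prime).one_lt
  have hp0 : (0 : ℝ) < p := by positivity
  have hnormf : (p : ℝ) ^ 2 * ‖x‖ ^ 2 ≤ ‖((constantCoeff f : ℤ_[p]) : ℚ_[p])‖ := by
    calc (p : ℝ) ^ 2 * ‖x‖ ^ 2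
        = ((p : ℝ) * ‖x‖) ^ 2 := by ring
      _ = ‖y‖ ^ 2 := by rw [hy, norm_mul, R1.norm_one_sub_div_eq p ha]
      _ = ‖algebraMap ℚ_[p] ℂ_[p] y‖ ^ 2 := by rw [norm_algebraMap']
      _ = ‖u‖ * ‖algebraMap ℚ_[p] ℂ_[p] y‖ ^ 2 := by rw [hu, one_mul]
      _ = ‖((constantCoeff Q : 𝓞_ℂ_[p]) : ℂ_[p])‖ := by rw [← hQ0, norm_mul, norm_pow]
      _ = ‖((constantCoeff G : 𝓞_ℂ_[p]) : ℂ_[p])‖ *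
            ‖algebraMap ℚ_[p] ℂ_[p] ((constantCoeff f : ℤ_[p]) : ℚ_[p])‖ := by
          rw [hfac, norm_mul]
      _ ≤ 1 * ‖algebraMap ℚ_[p] ℂ_[p] ((constantCoeff f : ℤ_[p]) : ℚ_[p])‖ :=
          mul_le_mul_of_nonneg_right (R1.norm_coe_padicComplexInt_le_one p _) (norm_nonneg _)
      _ = ‖((constantCoeff f : ℤ_[p]) : ℚ_[p])‖ := by rw [one_mul, norm_algebraMap']
  refine le_two_mul_sub_one_of_zpow_le p ?_
  rwa [← PadicInt.norm_def, PadicInt.norm_eq_zpow_neg_valuation hf0,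
    Padic.norm_eq_zpow_neg_valuation hx] at hnormf

end Algebra

/-! ### §2 Pointwise on tree objects: CTL₀ ∧ UB♭ ∧ value♭ ⟹ `ord_p f_ac(0) ≤ 2·(ord_p log_{ω_E} P − 1)` -/

section Pointwise

variable {K : Type} [Field K] [NumberField K] {W : WeierstrassCurve ℚ} [W.IsElliptic]
  [W.IsGloballyMinimal] {p : ℕ} [Fact p.Prime] {ι : K →+* ℚ_[p]}
  {P : (W.baseChange K).toAffine.Point}
  {κ : ZpExtension K p} {𝔮 : HeightOneSpectrum (𝓞 K)} {γ : Field.absoluteGaloisGroup K}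
  [Fact (κ.IsTopGenerator γ)]

/-- **UB, pointwise (every `p`).** CTL₀ at the X-slot `𝔮` (`HasCharValuationAt … n`: `X_ac^∅(E/K_∞)_𝔮` is
`Λ`-torsion with a generator of non-zero constant term of valuation `n`) ∧ UB♭ at `𝔮` (the principal ideal of
`Q` lies inside `Ch_Λ(X_ac 𝔮)·𝓞_{ℂ_p}⟦T⟧` — the Euler-system inclusion of the BDP main conjecture, the REVERSE
of the tree's open (2.4)♭) ∧ value♭ (`Q(𝟙) = u·((1 − a/p)·log_{ω_E} P)²`, `‖u‖ = 1`, `p ∤ a`, the logarithm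
through `ι`) ∧ `P` of infinite order ⟹ `n ≤ 2·(ord_p log_{ω_E} P − 1)`. The X-slot `𝔮` and the logarithm's
embedding `ι` are independent arguments (the oriented consumers take `𝔮 = 𝔭bar ≠ 𝔭_{ι'}` and move the
logarithm by rank-one symmetry). CONDITIONAL on the three shapes; nothing asserted about any curve.
[cite: Castella2018, §5 (5.1)–(5.3) (arXiv:1704.06608 p. 12) (the assembly, as an inequality)]
[cite: JetchevSkinnerWan2017, §7.4.2 (arXiv:1512.06894 p. 31) (the direction served)] -/
theorem charValuation_le_of_span_le_of_intValue {n : ℕ}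
    (hn : XAc.HasCharValuationAt (W.baseChange K) p κ 𝔮 ∅ γ n) {Q : PowerSeries 𝓞_ℂ_[p]}
    (hUB : Ideal.span {Q} ≤
      (XAc.charIdeal (W.baseChange K) p κ 𝔮 ∅ γ).map (PowerSeries.map (R1.toCpInt p)))
    {u : ℂ_[p]} (hu : ‖u‖ = 1) {a : ℤ} (ha : ¬ (p : ℤ) ∣ a) (hP : ¬ IsOfFinAddOrder P)
    (h2 : IntSeries.HasValueAt Q 0 (u *
      (algebraMap ℚ_[p] ℂ_[p] (((1 : ℚ_[p]) - (a : ℚ_[p]) * (p : ℚ_[p])⁻¹) * logOmega W p ι P)) ^ 2)) :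
    (n : ℤ) ≤ 2 * (X11b.padicLogOrd W p ι P - 1) := by
  obtain ⟨-, f, hf, hf0, hfn⟩ := hn
  have hmem : Q ∈ Ideal.span {PowerSeries.map (R1.toCpInt p) f} := by
    rw [hf, map_span_singleton_powerSeries] at hUB
    exact (Ideal.span_singleton_le_iff_mem _).mp hUB
  have hx0 : logOmega W p ι P ≠ 0 := R1.logOmega_ne_zero W p ι hP
  have hle := valuation_constantCoeff_le_int p hf0 hmem hu ha hx0 h2
  rw [valuation_logOmega hx0, hfn] at hle
  exact hle

end Pointwise

/-! ### §3 With the control identity: the SHARP upper bound on `Ш(E/K)` -/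

section Control

variable {K : Type} [Field K] [NumberField K] {W : WeierstrassCurve ℚ} [W.IsElliptic]
  [W.IsGloballyMinimal] {p : ℕ} [Fact p.Prime] {ι : K →+* ℚ_[p]}
  {P : (W.baseChange K).toAffine.Point}
  {κ : ZpExtension K p} {𝔮 : HeightOneSpectrum (𝓞 K)} {γ : Field.absoluteGaloisGroup K}
  [Fact (κ.IsTopGenerator γ)]

/-- **UB ∘ BDP ∘ CTL, pointwise: the Tamagawa-INCLUSIVE upper bound over `K`.** The control IDENTITY
`ControlOnTreeAt p κ 𝔮 γ ι P` (`ord_p f_ac(0) = ord_p #Ш(E/K)[p^∞] + 2·((ord_p log_ω P − 1) − ord_p[E(K):ℤP]) +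
ord_p ∏_{w∣N⁺} c_w(E/K)`, Cas18 Thm. 2.3 ∕ JSW17 Thm. 3.3.1 shape) and ANY instance of CTL₀ at the same X-slot
with `ord_p f_ac(0) ≤ 2·(ord_p log_ω P − 1)` (§2) give
`ord_p #Ш(E/K)[p^∞] + ord_p ∏_{w∣N⁺} c_w(E/K) ≤ 2·ord_p [E(K):ℤP]` — Castella's (5.2) with «≤»; the two
`ord_p f_ac(0)` agree by `XAc.HasCharValuationAt.unique`. Upper twin of
`X11b.two_mul_index_le_of_onTreeLowerLinks`. CONDITIONAL on the shapes.
[cite: Castella2018, Thm. 2.3 (arXiv:1704.06608 p. 5) and §5 (5.2) (p. 12)]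
[cite: JetchevSkinnerWan2017, Thm. 3.3.1 and §7.4.2 (arXiv:1512.06894 pp. 11, 31)] -/
theorem sha_add_tamagawaProductSplit_le_of_control {n : ℕ}
    (hn : XAc.HasCharValuationAt (W.baseChange K) p κ 𝔮 ∅ γ n)
    (hle : (n : ℤ) ≤ 2 * (X11b.padicLogOrd W p ι P - 1)) (hCTL : ControlOnTreeAt p κ 𝔮 γ ι P) :
    (padicValNat p (Nat.card (AddCommGroup.primaryComponent (W.baseChange K).sha p)) : ℤ) +
        padicValNat p (tamagawaProductSplit W K) ≤
      2 * (padicValNat p (AddSubgroup.zmultiples P).index : ℤ) := by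
  obtain ⟨n', hn', hne'⟩ := hCTL
  obtain rfl : n = n' := hn.unique hn'
  omega

/-- **… over a classical Heegner field** (`p ≥ 5`, `K` imaginary quadratic with the Heegner hypothesis for
`N = N_E`, `Ш(E/K)` finite — so `∏_{w∣N⁺} c_w = ∏_w c_w(E/K)` and `ord_p ∏_w c_w(E/K) = 2·ord_p ∏_ℓ c_ℓ(E)`,
theorems of the tree): `ord_p #Ш(E/K) + 2·ord_p ∏_ℓ c_ℓ(E) ≤ 2·ord_p [E(K):ℤP]` — the SHARP form of Kolyvagin's
`#Ш(E/K) ∣ p^{2·ord_p[E(K):ℤP]}` (sharper by exactly the Tamagawa defect `2·ord_p ∏c` of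
`BDPRouteTamagawaDefect.lean`). Upper twin of `X11b.indexLowerBoundAt_of_onTreeUpperLinks_of_heegner`.
CONDITIONAL on the shapes. [cite: JetchevSkinnerWan2017, §7.3.1 (eq:tamK) and §7.4.2 (arXiv:1512.06894 pp. 30–31)]
[cite: Castella2018, Thm. 2.3 (p. 5), §5 (5.2)–(5.3) (p. 12)] -/
theorem shaIndexBoundSharp_of_heegner (hp : 5 ≤ p) (hK : IsImaginaryQuadratic K) {N : ℕ}
    (hN : W.conductorNorm ℤ = N) (hH : SatisfiesHeegnerHypothesis N K) [Finite (W.baseChange K).sha]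
    {n : ℕ} (hn : XAc.HasCharValuationAt (W.baseChange K) p κ 𝔮 ∅ γ n)
    (hle : (n : ℤ) ≤ 2 * (X11b.padicLogOrd W p ι P - 1)) (hCTL : ControlOnTreeAt p κ 𝔮 γ ι P) :
    padicValNat p (W.baseChange K).shaOrder + 2 * padicValNat p W.tamagawaProduct ≤
      2 * padicValNat p (AddSubgroup.zmultiples P).index := by
  haveI : Finite (AddCommGroup.primaryComponent (W.baseChange K).sha p) :=
    Finite.of_injective _ Subtype.val_injective
  have h := sha_add_tamagawaProductSplit_le_of_control hn hle hCTL
  rw [padicValNat_tamagawaProductSplit_eq_of_heegner W p K hp hK hN hH,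
    padicValNat_tamagawaProduct_baseChange_of_heegner W p hp K hK hN hH,
    padicValNat_card_addPrimaryComponent] at h
  rw [WeierstrassCurve.shaOrder]
  omega

end Control

/-! ### §4 The ℚ-descent: the sharp bound over `K` ⟹ `Typed.MissingUpperBoundAt W p`, NO Tamagawa condition -/

section Descent

/-- **The Euler-system half of `BSD(E,p)` from the SHARP upper bound over a classical Heegner field — no
condition on the Tamagawa numbers.** Data as in the tree's `missingUpperBoundAt_of_shaIndexBound` (`W/ℚ`
globally minimal, `ord_{s=1}L(E,s) = 1`; `K` imaginary quadratic with the Heegner hypothesis for `N` and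
`L(E^{d_K},1) ≠ 0`; `P` the Heegner point of a datum with `p ∤ c`; `p` odd, `p ∤ #𝓞_K^×`; `Wd = Cd • W^{(d_K)}`
globally minimal with `ord_p u(Cd) = 0` and `ord_p ∏c(Wd) = ord_p ∏c(W)`); PUBLISHED binders `hGZ`, `hKo`,
`hGZK`, `hmod`; the `≥`-half of the rank-`0` `p`-part of the twist (`htw`, Skinner 2016 Thm. C shape); and,
instead of Kolyvagin's bound, the SHARP bound `hU♯ : ord_p #Ш(E/K) + 2·ord_p ∏c(E) ≤ 2·ord_p[E(K):ℤP]` (granted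
finiteness of `Ш(E/K)` and `P` of infinite order) — the output of §3. CONCLUSION: `Typed.MissingUpperBoundAt W p`.
Arithmetic (`v = ord_p`): `v(Ш_W) + v(Ш_d) + 2v(c_W) = v(Ш_K) + 2v(c_W) ≤ 2v(I) = v(q) + v(q_d) + v(c_W) + 2v(t_d)
≤ v(q) + v(Ш_d) + v(c_d) + v(c_W) = v(q) + v(Ш_d) + 2v(c_W)`, so `v(Ш_W) ≤ v(q) = v(#Ш(E)_an)` — the Tamagawa
term CANCELS instead of being dropped. CONDITIONAL on `hU♯`; nothing booked.
[cite: JetchevSkinnerWan2017, §7.4.2 (eq:shaupper) and (eq:tamK) (arXiv:1512.06894 p. 31)]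
[cite: Castella2018, §5 (5.2)–(5.3) (arXiv:1704.06608 p. 12)] [cite: Miller2011LMS, Def. 1.1 (arXiv:1010.2431 p. 3)] -/
theorem missingUpperBoundAt_of_shaIndexBoundSharp
    (W : WeierstrassCurve ℚ) [W.IsElliptic] [W.IsGloballyMinimal] (p : ℕ) [Fact p.Prime]
    (N : ℕ) [NeZero N] (K : Type) [Field K] [NumberField K]
    (Dt : ModularParametrizationData W N) (H : HeegnerDatum N (NumberField.discr K)) (ι : K →+* ℂ)
    (P : (W.baseChange K).toAffine.Point)
    -- the published inputs (named facts of the tree)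
    (hGZ : gross_zagier N W K) (hKo : kolyvagin N W K)
    (hGZK : rank_eq_analyticRank_of_analyticRank_le_one) (hmod : hasEntireLFunction_rat)
    -- the data
    (hK : IsImaginaryQuadratic K) (hHN : SatisfiesHeegnerHypothesis N K)
    (hP : WeierstrassCurve.Affine.Point.map ι.toRatAlgHom P = heegnerPointComplex Dt H)
    (hp2 : p ≠ 2) (hc : ¬ (p : ℤ) ∣ Dt.c) (hμ : ¬ p ∣ Units.torsionOrder K)
    (hr : W.analyticRank = 1)
    (hLt : (W.quadraticTwist (NumberField.discr K : ℚ)).entireLFunction 1 ≠ 0)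
    -- a globally minimal model of the quadratic twist by `d_K`
    (Wd : WeierstrassCurve ℚ) [Wd.IsElliptic] [Wd.IsGloballyMinimal] (Cd : VariableChange ℚ)
    (hWd : Cd • W.quadraticTwist (NumberField.discr K : ℚ) = Wd)
    (hu : padicValRat p (Cd.u : ℚ) = 0)
    (htam : padicValNat p Wd.tamagawaProduct = padicValNat p W.tamagawaProduct)
    -- the `≥`-half of the rank-zero `p`-part for the twist
    (htw : ∃ q : ℚ, Wd.entireLFunction 1 / (Wd.realPeriodRat : ℂ) = (q : ℂ) ∧
      padicValRat p q ≤ (padicValNat p Wd.shaOrder : ℤ) + padicValNat p Wd.tamagawaProduct -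
        2 * padicValNat p Wd.torsionOrder)
    -- the SHARP upper bound over `K` (UB ∘ BDP ∘ CTL, §3)
    (hU : Finite (W.baseChange K).sha → ¬ IsOfFinAddOrder P →
      padicValNat p (W.baseChange K).shaOrder + 2 * padicValNat p W.tamagawaProduct ≤
        2 * padicValNat p (AddSubgroup.zmultiples P).index) :
    Typed.MissingUpperBoundAt W p := by
  obtain ⟨qd, hqd, hvqd⟩ := htw
  obtain ⟨-, hfinK, hsha, q, hq, hval⟩ := exists_shaAn_padicVal_eq_of_heegner W p N K Dt H ι P
    hGZ hKo hGZK hmod hK hHN hP hp2 hc hμ hr hLt Wd Cd hWd hu qd hqd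
  -- the Heegner point has infinite order (`L'(E,1) ≠ 0`, `L(E^D,1) ≠ 0`, Gross–Zagier)
  have hL0 : W.entireLFunction 1 = 0 := entireLFunction_one_eq_zero_of_analyticRank_eq_one hr
  obtain ⟨-, hderiv⟩ := leadingLCoeff_eq_deriv_of_analyticRank_eq_one hr
  have hLK : LDerivEK W K ≠ 0 := by
    rw [lDerivEK_eq_deriv_mul W K hmod hL0]; exact mul_ne_zero hderiv hLt
  have hPinf : ¬ IsOfFinAddOrder P :=
    (lDerivEK_ne_zero_iff_not_isOfFinAddOrder W N K hGZ hK hHN ⟨Dt, H, ι, hP⟩).mp hLK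
  have hKU := hU hfinK hPinf
  refine ⟨q, hq, ?_⟩
  have e1 : (padicValNat p (W.baseChange K).shaOrder : ℤ) + 2 * padicValNat p W.tamagawaProduct ≤
      2 * padicValNat p (AddSubgroup.zmultiples P).index := by exact_mod_cast hKU
  have e2 : (padicValNat p (W.baseChange K).shaOrder : ℤ) =
      padicValNat p W.shaOrder + padicValNat p Wd.shaOrder := by exact_mod_cast hsha
  have e3 : (padicValNat p Wd.tamagawaProduct : ℤ) = padicValNat p W.tamagawaProduct := by
    exact_mod_cast htam
  omega

/-- **The same at odd-`d_K` Heegner data with the twist-model transports discharged** (`p` odd, `d_K` odd,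
`p ∤ d_K`; `Mult W p`): `ord_p u(Cd) = 0` (`padicValRat_u_eq_zero_of_twist_minimal`) and
`ord_p ∏c(Wd) = ord_p ∏c(W)` (`X2.padicValNat_tamagawaProduct_twist_of_heegner_of_odd`) are theorems; the twist's
`≥`-half stays a hypothesis ON THE MINIMAL MODEL `Wd` (supplied on (ram) by Skinner 2016 Thm. C, on ¬(ram) by crux
`X11aLowerHalf` — companion file). CONDITIONAL on `hU♯` and `htw`.
[cite: JetchevSkinnerWan2017, §7.4.2 (arXiv:1512.06894 p. 31)] [cite: Miller2011LMS, Def. 1.1] -/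
theorem missingUpperBoundAt_of_shaIndexBoundSharp_of_odd
    (W : WeierstrassCurve ℚ) [W.IsElliptic] [W.IsGloballyMinimal] (p : ℕ) [Fact p.Prime]
    [NeZero (W.conductorNorm ℤ)] (K : Type) [Field K] [NumberField K]
    (Dt : ModularParametrizationData W (W.conductorNorm ℤ))
    (H : HeegnerDatum (W.conductorNorm ℤ) (NumberField.discr K)) (ι : K →+* ℂ)
    (P : (W.baseChange K).toAffine.Point)
    -- the published inputs (named facts of the tree)
    (hGZ : gross_zagier (W.conductorNorm ℤ) W K) (hKo : kolyvagin (W.conductorNorm ℤ) W K)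
    (hGZK : rank_eq_analyticRank_of_analyticRank_le_one) (hmod : hasEntireLFunction_rat)
    -- the pair
    (hr : W.analyticRank = 1) (hp2 : p ≠ 2) (hmult : Mult W p)
    -- the Heegner data (`d_K` odd, `p ∤ d_K`)
    (hK : IsImaginaryQuadratic K) (hodd : Odd (NumberField.discr K))
    (hpd : ¬ (p : ℤ) ∣ NumberField.discr K)
    (hHN : SatisfiesHeegnerHypothesis (W.conductorNorm ℤ) K)
    (hP : WeierstrassCurve.Affine.Point.map ι.toRatAlgHom P = heegnerPointComplex Dt H)
    (hc : ¬ (p : ℤ) ∣ Dt.c) (hμ : ¬ p ∣ Units.torsionOrder K)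
    (hLt : (W.quadraticTwist (NumberField.discr K : ℚ)).entireLFunction 1 ≠ 0)
    (Wd : WeierstrassCurve ℚ) [Wd.IsElliptic] [Wd.IsGloballyMinimal] (Cd : VariableChange ℚ)
    (hWd : Cd • W.quadraticTwist (NumberField.discr K : ℚ) = Wd)
    -- the `≥`-half of the rank-zero `p`-part for the twist, on its minimal model
    (htw : ∃ q : ℚ, Wd.entireLFunction 1 / (Wd.realPeriodRat : ℂ) = (q : ℂ) ∧
      padicValRat p q ≤ (padicValNat p Wd.shaOrder : ℤ) + padicValNat p Wd.tamagawaProduct -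
        2 * padicValNat p Wd.torsionOrder)
    -- the SHARP upper bound over `K`
    (hU : Finite (W.baseChange K).sha → ¬ IsOfFinAddOrder P →
      padicValNat p (W.baseChange K).shaOrder + 2 * padicValNat p W.tamagawaProduct ≤
        2 * padicValNat p (AddSubgroup.zmultiples P).index) :
    Typed.MissingUpperBoundAt W p := by
  have htam : padicValNat p Wd.tamagawaProduct = padicValNat p W.tamagawaProduct :=
    X2.padicValNat_tamagawaProduct_twist_of_heegner_of_odd W p hp2 K hK hodd hpd hHN Cd hWd
  have hu : padicValRat p (Cd.u : ℚ) = 0 :=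
    padicValRat_u_eq_zero_of_twist_minimal W p K hK hHN hmult Cd hWd
  exact missingUpperBoundAt_of_shaIndexBoundSharp W p (W.conductorNorm ℤ) K Dt H ι P hGZ hKo hGZK hmod hK
    hHN hP hp2 hc hμ hr hLt Wd Cd hWd hu htam htw hU

end Descent

end Summit.BirchSwinnertonDyer.BirchSwinnertonDyer.Theorems.EulerHalfUB

end
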